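import Mathlib

/-!
# SoloBlind — FLAT FAMILIES (generalised partial-linear-space) summation lemma.
solo-HodgeConjecture-blind s42, type1-imprimitive.md §11 (LEMMA GPLS), CLAIMS SB-C328.

For ANY finite family of "flats" `F ⊂ α` and a two-point function `g` with vanishing
diagonal, the flat-by-flat full double sums add up to the sum over ordered off-diagonal
pairs weighted by the number `N(c,c')` of flats containing both points:
`Σ_F Σ_{c,c' ∈ F} g c c' = Σ_{c ≠ c'} N(c,c') • g c c'`.
This is the identity `tr_{Z_𝓕/X}(T_𝓕 α ∧ T_𝓕 β) = Σ_O N_𝓕(O) · Θ_O(α ⊠ β)` behind the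
Johnson/Hamming inversions (there `N` restricted to an orbital is the constant `N_𝓕(O)`).
Also recorded: the Johnson incidence count — two `k`-sets meeting in an `i`-set contain
exactly `C(i,j)` common `j`-subsets — which makes the incidence matrix unitriangular.
-/

namespace Summit.HodgeConjecture.HodgeConjecture.Theorems.FlatFamilies

open Finset

variable {α : Type*} [Fintype α] [DecidableEq α] {M : Type*} [AddCommMonoid M]

/-- The number of flats containing both coordinates of an ordered pair. -/
def pairCount (flats : Finset (Finset α)) (p : α × α) : ℕ :=
  (flats.filter (fun F => p.1 ∈ F ∧ p.2 ∈ F)).card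

/-- A flat's full double sum is the sum over all ordered pairs of the indicator-weighted
function. -/
theorem sum_flat_eq_sum_univ (F : Finset α) (g : α → α → M) :
    ∑ c ∈ F, ∑ c' ∈ F, g c c' =
      ∑ p ∈ (Finset.univ : Finset (α × α)), (if p.1 ∈ F ∧ p.2 ∈ F then g p.1 p.2 else 0) := by
  rw [← Finset.sum_product']
  rw [← Finset.sum_filter]
  congr 1
  ext p
  simp [Finset.mem_product]

/-- **GPLS summation (all ordered pairs).**  Flat-by-flat double sums add up to the
pair-count-weighted sum over all ordered pairs. -/
theorem sum_flats_eq_sum_pairCount (flats : Finset (Finset α)) (g : α → α → M) :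
    ∑ F ∈ flats, ∑ c ∈ F, ∑ c' ∈ F, g c c' =
      ∑ p ∈ (Finset.univ : Finset (α × α)), pairCount flats p • g p.1 p.2 := by
  simp_rw [sum_flat_eq_sum_univ]
  rw [Finset.sum_comm]
  refine Finset.sum_congr rfl ?_
  intro p _
  rw [← Finset.sum_filter, Finset.sum_const]
  rfl

/-- **GPLS summation (off-diagonal form).**  If the diagonal terms vanish ("a 2-form
pulled back from a curve is zero"), only the off-diagonal ordered pairs contribute, each
weighted by the number of flats through it. -/
theorem sum_flats_bilinear (flats : Finset (Finset α)) (g : α → α → M)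
    (hdiag : ∀ c, g c c = 0) :
    ∑ F ∈ flats, ∑ c ∈ F, ∑ c' ∈ F, g c c' =
      ∑ p ∈ (Finset.univ : Finset α).offDiag, pairCount flats p • g p.1 p.2 := by
  rw [sum_flats_eq_sum_pairCount]
  have huniv : (Finset.univ : Finset (α × α)) = (Finset.univ : Finset α) ×ˢ (Finset.univ : Finset α) := by
    ext p; simp
  rw [huniv, ← Finset.diag_union_offDiag, Finset.sum_union (Finset.disjoint_diag_offDiag _)]
  have hd : ∑ p ∈ (Finset.univ : Finset α).diag, pairCount flats p • g p.1 p.2 = 0 := by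
    refine Finset.sum_eq_zero ?_
    intro p hp
    rw [Finset.mem_diag] at hp
    rw [← hp.2, hdiag, smul_zero]
  rw [hd, zero_add]

omit [Fintype α] in
/-- **Johnson incidence count.**  Two finite sets whose intersection has `i` elements
contain exactly `C(i,j)` common `j`-subsets (the subsets of the intersection); in
particular none if `j > i` and exactly one if `j = i` — the incidence matrix
`(C(i,j))_{i,j}` is unitriangular. -/
theorem card_common_subsets (c c' : Finset α) (j : ℕ) :
    ((c ∩ c').powersetCard j).card = Nat.choose (c ∩ c').card j := by
  rw [Finset.card_powersetCard]

omit [Fintype α] in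
/-- A `j`-set lies in both `c` and `c'` iff it lies in their intersection. -/
theorem subset_both_iff (c c' J : Finset α) : (J ⊆ c ∧ J ⊆ c') ↔ J ⊆ c ∩ c' := by
  rw [Finset.subset_inter_iff]

/-- Unitriangularity of the Johnson incidence matrix: zero above the diagonal, one on it. -/
theorem choose_unitriangular (i j : ℕ) :
    (i < j → Nat.choose i j = 0) ∧ Nat.choose i i = 1 :=
  ⟨fun h => Nat.choose_eq_zero_of_lt h, Nat.choose_self i⟩

end Summit.HodgeConjecture.HodgeConjecture.Theorems.FlatFamilies
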